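import Mathlib
import HarnessLib
import Summits.CriticalPhenomena.SAWScalingLimit.Theses.SAWPoincareChain
import Literature.Probability.RandomPlanarGeometry.CurveTortuosity
import Literature.Probability.RandomPlanarGeometry.SLEConvergenceCriterion

/-!
# Birth skeleton for the crux `SAWPoincareChain.SubCurvatureTightness` (stmt-CriticalPhenomena-7557)

Route `route-CriticalPhenomena-SAWPoincareChain` (sub-problem `SAWScalingLimit`), crux #4 (rank 4):
for every `Q` with the ChainLaw property, the disc laws `Q t (𝔻; 1, −1)` of the Poincaré tangent-bead
chain are TIGHT as `t → 0⁺` in the eventual sense (`IsTightAlongMesh` of the identity variable) and every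
subsequential limit is carried by SIMPLE curves meeting the unit circle ONLY at `1` and `−1`.
Registered by the skeleton registrar `planner-skel-stmt-CriticalPhenomena-7557-0` (2026-08-17, route
re-audit bin REPAIRABLE); published as `Cruxes/SubCurvatureTightness/Lines/birth.lean`.

## The line in one paragraph (the route's own "foreseen tools", typed)

Tightness is factored through Aizenman–Burchard: **T1** (`stub_shellTraversalBound`, HARDEST, open) is the
AB input for THIS object — an all-scale bound `Q t 𝔻 {k separate traversals of D(x; ρ, R)} ≤ K (ρ/R)^λ`,
`λ > 2`, one fixed threshold `k`, uniformly in small `t`, with NO short-distance cutoff (the Euclidean bead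
size `≍ t(1-‖x‖²)` degenerates at `∂𝔻` and the bi-infinite chain has infinitely many beads at the ideal
marks, so AB's cutoff hypothesis (H0) is false near `±1`; below the local bead scale `k ≥ 8` traversals are
deterministically impossible by the hard core, above it the bound is the conjectural `2k`-arm decay, near
`∂𝔻` it is hyperbolic escape); **T2** (`stub_tightOfTraversalBound`, size L, provable now from tree
lemmas) is AB99 run without cutoff on `CurveClass ℂ`: all-scale traversal bound + chordality ⇒
`IsTightAlongMesh`.  The support half is split by MECHANISM: **T3** (`stub_limitsSimple`, open, the flat
critical-SAW problem: no near-self-touching at sub-curvature scales) and **T4**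
(`stub_limitsTouchOnlyAtMarks`, the hyperbolic large-scale half: ballisticity + renewal keep the chain off
`∂𝔻` away from `±1`).

  SubCurvatureTightness
    ⇐ (IsTightAlongMesh ⇐ T2 (T1))  ∧  (a.s. simple ⇐ T3)  ∧  (a.s. touches ∂𝔻 only at ±1 ⇐ T4)

`SubCurvatureTightness_of` (no `sorry`) composes the four registered stubs and concludes the crux BY NAME;
`sorry` occurs only inside `stub_*`; hypotheses are the name-keyed aliases `Registered.stub_*`.

## BC3 audit (registrar, 2026-08-17; raw outputs in the registrar's NOTES.md)

* `lean check --json` of this file: rc 0, sorries = 4 = stubs (`stub_shellTraversalBound`,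
  `stub_tightOfTraversalBound`, `stub_limitsSimple`, `stub_limitsTouchOnlyAtMarks`), zero elsewhere.
* Probes (`bc/probe_<Stub>.lean`, same vocabulary, `first | exact? | simpa | simpa [defs] | (unfold; simpa)
  | aesop`, `maxHeartbeats 400000`): for each of the four stubs, `stub → SubCurvatureTightness` FAILS and
  `stub → _root_.SAWScalingLimit` FAILS (8/8 failures) — no stub is cheaply the crux or the summit.
  (Conversely T3 and T4 are pieces of the crux's second conjunct, hence consequences of it — they are used
  toward it, which is what BC allows.)

## Disproof used / dead lines

No `Cruxes/SubCurvatureTightness/Disproof.lean` and no `Lines/*` existed at registration (`ledger crux ls`: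
no workfiles); `ledger negatives`: the only nearby negative is stmt-CriticalPhenomena-0772 (the ALL-`δ`
tightness of the `ℤ²` SAW, refuted) — every statement here is EVENTUAL in `t` (`∀ᶠ t in 𝓝[>] 0` /
`IsTightAlongMesh`), never the all-`t` form.
-/

noncomputable section

open scoped BigOperators Topology Manifold Classical MeasureTheory ProbabilityTheory Matrix InnerProductSpace ComplexConjugate ContinuousMap
open Filter Set Function TopologicalSpace MeasureTheory
open Summit.CriticalPhenomena.SAWScalingLimit.Theses.SAWPoincareChain (SubCurvatureTightness)

namespace Summit.CriticalPhenomena.SAWScalingLimit.Cruxes.SubCurvatureTightness.Birth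

/-! ## §0 Vocabulary of the line -/

/-- **The ChainLaw property of `Q`** — VERBATIM the hypothesis of the crux
`SAWPoincareChain.SubCurvatureTightness` (and the body of `SAWPoincareChain.ChainLaw`): eventually in
the step `t → 0⁺`, `Q t` is chordal, exactly conformally covariant, and `Q t (𝔻; 1, −1)` is the weak
limit (`ρ = 1 − r → 1⁻`) of the normalised `x_c`-weighted tangent-bead Poincaré-chain approximants.
Named here only to keep the stub signatures short; `SubCurvatureTightness_of` checks definitionally
that it IS the crux hypothesis. [route SAWPoincareChain, items stmt-CriticalPhenomena-7556/7557] -/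
def ChainHyp (Q : ℝ → Literature.Probability.RandomPlanarGeometry.ChordalFamily) : Prop :=
  ∀ᶠ t in nhdsWithin (0:ℝ) (Set.Ioi 0), (Q t).IsChordal ∧ (Q t).IsConformallyCovariant ∧ Literature.Probability.RandomPlanarGeometry.TendstoLaw (fun (_ : ℝ) (x : Literature.Probability.RandomPlanarGeometry.CurveClass ℂ) => x) (fun r => (fun S : MeasureTheory.Measure (Literature.Probability.RandomPlanarGeometry.CurveClass ℂ) => (S Set.univ)⁻¹ • S) ((fun (xc t ρ : ℝ) (pos : (ℕ → ℝ) → ℕ → ℂ) => MeasureTheory.Measure.sum fun n : ℕ => ENNReal.ofReal ((xc / (2 * Real.pi)) ^ n) • ((MeasureTheory.volume.restrict {θ : Fin n → ℝ | (∀ k, θ k ∈ Set.Ico (0:ℝ) (2 * Real.pi)) ∧ (∀ i j : ℕ, i + 2 ≤ j → j ≤ n → t * ‖1 - (starRingEnd ℂ) (pos (fun k => if h : k < n then θ ⟨k, h⟩ else 0) i) * pos (fun k => if h : k < n then θ ⟨k, h⟩ else 0) j‖ < ‖pos (fun k => if h : k < n then θ ⟨k, h⟩ else 0) i - pos (fun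 k => if h : k < n then θ ⟨k, h⟩ else 0) j‖) ∧ 2 * ‖pos (fun k => if h : k < n then θ ⟨k, h⟩ else 0) n + ↑ρ‖ ≤ ‖1 + ↑ρ * pos (fun k => if h : k < n then θ ⟨k, h⟩ else 0) n‖}).map (fun θ => Literature.Probability.RandomPlanarGeometry.CurveClass.mk (⟨Literature.Probability.LatticeModels.polyline ((List.range (n + 1)).map (pos (fun k => if h : k < n then θ ⟨k, h⟩ else 0)))⟩ : Literature.Probability.RandomPlanarGeometry.Curve ℂ)))) ((⨅ n : ℕ, ((MeasureTheory.volume {θ : Fin (n + 1) → ℝ | (∀ k, θ k ∈ Set.Ico (0:ℝ) (2 * Real.pi)) ∧ ∀ i j : ℕ, i + 2 ≤ j → j ≤ n + 1 → 1 < ‖(List.range i).foldl (fun (z : ℂ) (m : ℕ) => z + Complex.exp (↑(if h : m < n + 1 then θ ⟨m, h⟩ else 0) * Complex.I)) 0 - (List.range j).foldl (fun (z : ℂ) (m : ℕ) => z + Complex.exp (↑(if h : m < n + 1 then θ ⟨m, h⟩ else 0) * Complex.I)) 0‖}).toReal / (2 * Real.pi) ^ (n + 1)) ^ (1 / ((n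 : ℝ) + 1)))⁻¹) t (1 - r) (fun θ k => (List.range k).foldl (fun (z : ℂ) (j : ℕ) => (z + ↑t * Complex.exp (↑(θ j) * Complex.I)) / (1 + (starRingEnd ℂ) z * (↑t * Complex.exp (↑(θ j) * Complex.I)))) (↑(1 - r) : ℂ)))) id (Q t Literature.Probability.RandomPlanarGeometry.DobrushinDomain.unitDisc)

/-- **`k`-fold traversal event on curve classes**: the class `c` has a representative traversing the
shell `D(x; ρ, R)` by `k` separate segments (Aizenman–Burchard 1999 §1.b (1.3), tree notion
`Curve.HasTraversals` of `CurveTortuosity.lean`).  Stated with `∃` over representatives (the disc laws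
live on `CurveClass ℂ`, variable = identity); since `HasTraversals` passes to nearby curves with `ε` of
room (`CurveTraversalCompact.lean`), this is "every representative traverses every slightly thinner shell
`k` times". Only OUTER measure of this set is ever used. [AizenmanBurchard1999 §1.b] -/
def travClass (k : ℕ) (x : ℂ) (ρ R : ℝ) :
    Set (Literature.Probability.RandomPlanarGeometry.CurveClass ℂ) :=
  {c | ∃ γ : Literature.Probability.RandomPlanarGeometry.Curve ℂ,
    Literature.Probability.RandomPlanarGeometry.CurveClass.mk γ = c ∧ γ.HasTraversals k x ρ R}

/-- **All-scale Aizenman–Burchard input for the disc laws of `Q`** (AB99 hypothesis (1.3) = H1, with ONE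
fixed threshold `k`, exponent `λ > 2 = dim`, NO short-distance cutoff): eventually in `t`, for every
centre `x ∈ ℂ` and radii `0 < ρ < R ≤ 1`,
`Q t 𝔻 {k separate traversals of D(x; ρ, R)} ≤ K (ρ/R)^λ`.
Why no cutoff is the right typing for THIS object (unlike `δℤ²` walks): the Euclidean bead size
`≍ t (1 - ‖x‖²)` degenerates at `∂𝔻` and the bi-infinite chain has infinitely many beads at the ideal
marks `±1`, so AB's cutoff hypothesis (H0) ("a.s. no `k`-fold traversal below scale `δ`") is FALSE near
`±1` for every uniform `δ`; instead (i) below the local bead scale `k ≥ 8` separate traversals are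
deterministically impossible (at most three pairwise disjoint equal hyperbolic beads meet a much smaller
ball; each `R`-separated visit uses a different bead), (ii) above it the bound is the conjectural
polychromatic `2k`-arm decay of the critical SAW (`λ(k) → ∞`), (iii) near `∂𝔻` and the marks it is
hyperbolic escape (each return from Euclidean distance `R` to `ρ` of an ideal/boundary point costs
hyperbolic backtracking `≍ log (R/ρ)`, exponentially unlikely for a ballistic chain with renewals,
arXiv:2007.03534 Thm 1.1; dilation invariance of the bi-infinite chain in the `ℍ` picture). -/
def TraversalBound (Q : ℝ → Literature.Probability.RandomPlanarGeometry.ChordalFamily) : Prop :=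
  ∃ (k : ℕ) (K lam : ℝ), 2 < lam ∧
    ∀ᶠ t in nhdsWithin (0:ℝ) (Set.Ioi 0), ∀ (x : ℂ) (ρ R : ℝ), 0 < ρ → ρ < R → R ≤ 1 →
      Q t Literature.Probability.RandomPlanarGeometry.DobrushinDomain.unitDisc (travClass k x ρ R)
        ≤ ENNReal.ofReal (K * (ρ / R) ^ lam)

/-- **Statement T1 (HARDEST; the "RSW for SAW" content of the crux, off lattice):** every `Q` with the
ChainLaw property satisfies the all-scale traversal bound `TraversalBound Q`. -/
def ShellTraversalBound : Prop :=
  ∀ Q : ℝ → Literature.Probability.RandomPlanarGeometry.ChordalFamily, ChainHyp Q → TraversalBound Q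

/-- **Statement T2 (Aizenman–Burchard on the quotient, no cutoff; size L, PROVABLE NOW):** for ANY
`t`-family of chordal laws (`(Q t).IsChordal` eventually: probability measures carried by curves in the
closed disc — all that is used of ChainLaw here), the all-scale traversal bound implies tightness along
the mesh filter of the disc laws.  Proof = AB99 §3.a + §4 run WITHOUT the cutoff: scales `ℓ_n = 2^{-n}`,
inner radii `ρ_n = ℓ_n^{1+ε}/8` with `ε = 3/(λ-2)`, `ρ_n`-nets `S_n` of the closed unit disc
(`exists_finset_card_le_cover_closedBall`, `#S_n ≤ C ρ_n^{-2}`); the bad event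
`⋃_{n ≥ n₀} ⋃_{y ∈ S_n} travClass k y ρ_n (ℓ_n/2 - ρ_n)` has outer measure
`≤ Σ_{n ≥ n₀} #S_n K (8ρ_n/3ℓ_n)^λ → 0` (`λ > 2`; `measure_iUnion_le`); off it (and on
`range ⊆ closedBall 0 1`, a.s. by chordality, a closed condition) ANY representative has
`tortuosity ℓ_n ≤ k #S_n` for all `n ≥ n₀` (`Curve.tortuosity_le_of_cover`), i.e. the class lies in the
compact `closure (mk '' {range ⊆ Λ ∧ ∀ n ≥ n₀, tortuosity ≤ Φ n})`
(`CurveClass.isCompact_closure_image_mk_of_tortuosity_le`).  Differs from the tree's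
`isTightMeasureSet_of_traversalBounds` (`CurveTightness.lean`) exactly in dropping (H0) and in living on
`CurveClass`-valued identity variables. [AizenmanBurchard1999 Thms 1.1–1.2, Lemma 3.1, Lemma 4.1] -/
def TightOfTraversalBound : Prop :=
  ∀ Q : ℝ → Literature.Probability.RandomPlanarGeometry.ChordalFamily,
    (∀ᶠ t in nhdsWithin (0:ℝ) (Set.Ioi 0), (Q t).IsChordal) → TraversalBound Q →
      Literature.Probability.RandomPlanarGeometry.IsTightAlongMesh
        (fun (_ : ℝ) (x : Literature.Probability.RandomPlanarGeometry.CurveClass ℂ) => x)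
        (fun t => Q t Literature.Probability.RandomPlanarGeometry.DobrushinDomain.unitDisc)

/-- **Statement T3 (interior simplicity of subsequential limits; the FLAT critical-SAW problem at
sub-curvature scales, open):** for every `Q` with the ChainLaw property, every subsequential weak limit
`μ` (probability) of the disc laws `Q t 𝔻`, `t → 0⁺`, is carried by SIMPLE curves.  Mechanism foreseen:
a uniform-in-`t` "no narrow fjord / no near-self-touching" estimate for the chain (6-arm-type bound with
exponent `> 2`, the off-lattice analogue of the `δℤ²` items of routes SAWRenewalTightness /
SAWConfRestriction), then the closed-set portmanteau step; NOT implied by `TraversalBound` (Hölder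
regularity allows double points). Kill: restriction + non-simple limits ⇒ `α > 5/8` (route KILL
CRITERIA) — a refutation here closes the whole line. [AizenmanBurchard1999 §1; KemppainenSmirnov2017 §1.2;
DuminilCopinSmirnov2012 Conj. 1; LawlerSchrammWerner2004SAW §4.1] -/
def LimitsSimple : Prop :=
  ∀ Q : ℝ → Literature.Probability.RandomPlanarGeometry.ChordalFamily, ChainHyp Q →
    ∀ μ : MeasureTheory.Measure (Literature.Probability.RandomPlanarGeometry.CurveClass ℂ),
      MeasureTheory.IsProbabilityMeasure μ →
      Literature.Probability.RandomPlanarGeometry.IsSubseqLimitLaw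
        (fun (_ : ℝ) (x : Literature.Probability.RandomPlanarGeometry.CurveClass ℂ) => x)
        (fun t => Q t Literature.Probability.RandomPlanarGeometry.DobrushinDomain.unitDisc) μ →
      ∀ᵐ γ ∂μ, γ ∈ Literature.Probability.RandomPlanarGeometry.CurveClass.simple

/-- **Statement T4 (boundary contact only at the marks; the HYPERBOLIC large-scale half, size L–XL):**
every subsequential limit of the disc laws is carried by curves meeting the unit circle only in
`{1, -1}`.  Mechanism foreseen (route: "hyperbolic large scales free"): at each small `t` the chordal
chain is ballistic along the axis `(1, −1)` with renewals at singly-crossed transversal geodesics, so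
its hyperbolic distance from the axis has uniformly-in-`t` tight (exponential) tails AWAY from the two
ideal endpoints; Euclidean distance to `∂𝔻` off any neighbourhood of `±1` is then bounded below in
probability uniformly in `t`, and `{γ | γ.range ∩ ∂𝔻 ⊆ N_η(±1)}`-type closed events pass to the limit
(portmanteau), `η ↓ 0`.  Why it might fail: sub-ballistic pinning of the critical (`x = 1/μ_flat`)
chain to the boundary (an adsorption effect at `t → 0`), cf. arXiv:2310.17299. [arXiv:2007.03534
Thm 1.1; arXiv:1709.10515 Thms 1.3–1.4; BillingsleyCPM1999 Thm 2.1] -/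
def LimitsTouchOnlyAtMarks : Prop :=
  ∀ Q : ℝ → Literature.Probability.RandomPlanarGeometry.ChordalFamily, ChainHyp Q →
    ∀ μ : MeasureTheory.Measure (Literature.Probability.RandomPlanarGeometry.CurveClass ℂ),
      MeasureTheory.IsProbabilityMeasure μ →
      Literature.Probability.RandomPlanarGeometry.IsSubseqLimitLaw
        (fun (_ : ℝ) (x : Literature.Probability.RandomPlanarGeometry.CurveClass ℂ) => x)
        (fun t => Q t Literature.Probability.RandomPlanarGeometry.DobrushinDomain.unitDisc) μ →
      ∀ᵐ γ ∂μ, γ.range ∩ frontier Literature.Probability.RandomPlanarGeometry.DobrushinDomain.unitDisc.carrier ⊆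
        {Literature.Probability.RandomPlanarGeometry.DobrushinDomain.unitDisc.pt 0,
         Literature.Probability.RandomPlanarGeometry.DobrushinDomain.unitDisc.pt 1}

/-! ## §1 The registered stubs (`sorry` lives ONLY in these four theorems; each restates its named
statement, `*_holds` below certify the agreement definitionally) -/

/-- **STUB T1 · `stub_shellTraversalBound`** (XL, OPEN — HARDEST) `= ShellTraversalBound`: the all-scale
`k`-fold shell-traversal bound with exponent `> 2` for the disc laws of the Poincaré chain at the flat
critical fugacity, uniformly in small `t`. -/
theorem stub_shellTraversalBound :
    ∀ Q : ℝ → Literature.Probability.RandomPlanarGeometry.ChordalFamily, ChainHyp Q → TraversalBound Q := by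
  sorry

/-- **STUB T2 · `stub_tightOfTraversalBound`** (L, PROVABLE NOW) `= TightOfTraversalBound`:
Aizenman–Burchard without cutoff on `CurveClass ℂ` (deterministic ingredients all in the tree:
`Curve.tortuosity_le_of_cover`, `CurveClass.isCompact_closure_image_mk_of_tortuosity_le`,
`exists_finset_card_le_cover_closedBall`). -/
theorem stub_tightOfTraversalBound :
    ∀ Q : ℝ → Literature.Probability.RandomPlanarGeometry.ChordalFamily,
      (∀ᶠ t in nhdsWithin (0:ℝ) (Set.Ioi 0), (Q t).IsChordal) → TraversalBound Q →
        Literature.Probability.RandomPlanarGeometry.IsTightAlongMesh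
          (fun (_ : ℝ) (x : Literature.Probability.RandomPlanarGeometry.CurveClass ℂ) => x)
          (fun t => Q t Literature.Probability.RandomPlanarGeometry.DobrushinDomain.unitDisc) := by
  sorry

/-- **STUB T3 · `stub_limitsSimple`** (XL, OPEN) `= LimitsSimple`: subsequential limits of the disc
laws are carried by simple curves. -/
theorem stub_limitsSimple :
    ∀ Q : ℝ → Literature.Probability.RandomPlanarGeometry.ChordalFamily, ChainHyp Q →
      ∀ μ : MeasureTheory.Measure (Literature.Probability.RandomPlanarGeometry.CurveClass ℂ),
        MeasureTheory.IsProbabilityMeasure μ →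
        Literature.Probability.RandomPlanarGeometry.IsSubseqLimitLaw
          (fun (_ : ℝ) (x : Literature.Probability.RandomPlanarGeometry.CurveClass ℂ) => x)
          (fun t => Q t Literature.Probability.RandomPlanarGeometry.DobrushinDomain.unitDisc) μ →
        ∀ᵐ γ ∂μ, γ ∈ Literature.Probability.RandomPlanarGeometry.CurveClass.simple := by
  sorry

/-- **STUB T4 · `stub_limitsTouchOnlyAtMarks`** (L–XL, OPEN; hyperbolic ballisticity) `=
LimitsTouchOnlyAtMarks`: subsequential limits meet the unit circle only at `1` and `-1`. -/
theorem stub_limitsTouchOnlyAtMarks :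
    ∀ Q : ℝ → Literature.Probability.RandomPlanarGeometry.ChordalFamily, ChainHyp Q →
      ∀ μ : MeasureTheory.Measure (Literature.Probability.RandomPlanarGeometry.CurveClass ℂ),
        MeasureTheory.IsProbabilityMeasure μ →
        Literature.Probability.RandomPlanarGeometry.IsSubseqLimitLaw
          (fun (_ : ℝ) (x : Literature.Probability.RandomPlanarGeometry.CurveClass ℂ) => x)
          (fun t => Q t Literature.Probability.RandomPlanarGeometry.DobrushinDomain.unitDisc) μ →
        ∀ᵐ γ ∂μ, γ.range ∩ frontier Literature.Probability.RandomPlanarGeometry.DobrushinDomain.unitDisc.carrier ⊆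
          {Literature.Probability.RandomPlanarGeometry.DobrushinDomain.unitDisc.pt 0,
           Literature.Probability.RandomPlanarGeometry.DobrushinDomain.unitDisc.pt 1} := by
  sorry

/-! ### Consistency: each named statement IS its registered stub (definitionally) -/

theorem shellTraversalBound_holds : ShellTraversalBound := stub_shellTraversalBound
theorem tightOfTraversalBound_holds : TightOfTraversalBound := stub_tightOfTraversalBound
theorem limitsSimple_holds : LimitsSimple := stub_limitsSimple
theorem limitsTouchOnlyAtMarks_holds : LimitsTouchOnlyAtMarks := stub_limitsTouchOnlyAtMarks

/-! ### Name-keyed aliases of the four statements (the hypotheses of the composition; device of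
`Cruxes/ShellCrossingBound/Lines/pinch-on-a-circle.lean`) -/
namespace Registered

/-- Alias of `ShellTraversalBound` keyed by the registered stub name. -/
abbrev stub_shellTraversalBound : Prop := ShellTraversalBound
/-- Alias of `TightOfTraversalBound` keyed by the registered stub name. -/
abbrev stub_tightOfTraversalBound : Prop := TightOfTraversalBound
/-- Alias of `LimitsSimple` keyed by the registered stub name. -/
abbrev stub_limitsSimple : Prop := LimitsSimple
/-- Alias of `LimitsTouchOnlyAtMarks` keyed by the registered stub name. -/
abbrev stub_limitsTouchOnlyAtMarks : Prop := LimitsTouchOnlyAtMarks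

end Registered

/-! ## §2 The composition: the four stubs imply the crux, BY NAME (kernel-checked; no `sorry` below).
Not a one-line seam: the chordality clause is extracted from the ChainLaw filter statement for T2, the
traversal bound of T1 is fed into T2, and the two almost-sure support statements T3/T4 are intersected
under each subsequential limit. -/

/-- **`SubCurvatureTightness_of`** — STUBS T1–T4 imply `SAWPoincareChain.SubCurvatureTightness`. -/
theorem SubCurvatureTightness_of (h1 : Registered.stub_shellTraversalBound)
    (h2 : Registered.stub_tightOfTraversalBound) (h3 : Registered.stub_limitsSimple)
    (h4 : Registered.stub_limitsTouchOnlyAtMarks) : SubCurvatureTightness := by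
  intro Q hQ
  have hchordal : ∀ᶠ t in nhdsWithin (0:ℝ) (Set.Ioi 0), (Q t).IsChordal :=
    Filter.Eventually.mono hQ fun t ht => ht.1
  have htrav : TraversalBound Q := h1 Q hQ
  refine ⟨h2 Q hchordal htrav, fun μ hμ hlim => ?_⟩
  filter_upwards [h3 Q hQ μ hμ hlim, h4 Q hQ μ hμ hlim] with γ hs hb
  exact ⟨hs, hb⟩

/-- Wiring check: the registered stubs feed `SubCurvatureTightness_of` as stated. -/
example : SubCurvatureTightness :=
  SubCurvatureTightness_of stub_shellTraversalBound stub_tightOfTraversalBound stub_limitsSimple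
    stub_limitsTouchOnlyAtMarks

end Summit.CriticalPhenomena.SAWScalingLimit.Cruxes.SubCurvatureTightness.Birth

end
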